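import Mathlib
import HarnessLib
import Summits.HubbardSuperconductivity.HubbardSuperconductivity.Theorems.KLProgrammeKLRegimeTwoVolumeLipBaseDefs
import Summits.HubbardSuperconductivity.HubbardSuperconductivity.Theorems.KLProgrammeKLRegimeTwoVolumeTowerBaseGrid

/-!
# Route `KLProgramme` — crux K3 ENGINE (stmt-HubbardSuperconductivity-20437), stub (e) proof-input «(e)-D-ROWS», G-4 (datum): THE GRID DEFECT OF THE UV ACTIONS AT
# A DEEP GRID PIN — route A's M4a at a COMMON frame, read for `klGridActionZero (bL) − klGridGlue (klGridActionZero L)`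
# (seat hubbard-kl-k3c4-p1 g24; `--supports` 20437; DROWS-SCOPE-g24 v8 §10.4)

`…TwoVolumeLipBaseTransferDoor.lipBaseDiff_pinned_le` (G-4 at the model) reads the base object `BD_base` of the two-volume Lipschitz tower from the profiles `E_g`
(deep grid pins), `ND_g` (all grid pins) of the GRID defect `klGridActionZero (bL) M β U μ K − klGridGlue L b M (klGridActionZero L M β U μ K)` of the UV grid
actions (`…TwoVolumeLipBaseDefs`).  Route A's M4a `…TwoVolumeScaleZeroTopFrame.hubbardGrid_sum_norm_kernel_twoVolume_stepZero_le` (k3c4-p1 g13) bounds exactly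
this at an `(R+R′)`-deep grid pin when both volumes carry the SAME frame `K` (covariance frame = counterterm frame; the fine frame `K″ := K`, so the frame-mismatch
profile `E` is fed by `(fsub K K).coeffNorm 0`): its keyed-`if` reading of the coarse kernel IS the kernel of `klGridGlue` (`Lit/GrassmannEffectiveActionCopies.kernel_copies_sum`
at `klGridBlockEmb_apply`, then route A's `…TowerBaseGridSplice.keyed_klGridBlockEquiv_eq`), and its covariances are the grid pull-backs of the UV covariance at cutoff
`klE0` written through the common volume-free sampled symbol (`…TowerBaseGridSymbol.hubbardCovAboveCT_eq_normalCovariance_sampled`).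

* `kernel_klGridGlue_eq_keyed` — the glued kernel as the explicit keyed reading;
* **`lipBaseGridDefect_pinned_le`** — M4a's bound for `Σ_{X p = w} ‖kernel (klGridActionZero (bL) − klGridGlue (klGridActionZero L)) X‖` at an `(R+R′)`-deep grid pin `w`,
  hypotheses = M4a's one-volume analytic data verbatim (`CL`, `CLf` := the two grid pull-backs at cutoff `klE0`, named by `hCL`, `hCLf`), `K″ = K`.

A composition of landed theorems; every analytic datum is a hypothesis; nothing asserts the (D) rows, stub (e), VL, K3 or superconductivity.
References: BGM 2003 §1.2 (2.10); BGM 2006 §2, §2.9 [cite: BenfattoGiulianiMastropietro2006]; Salmhofer 1999 §4.2.4.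
-/

noncomputable section

namespace Summit.HubbardSuperconductivity.HubbardSuperconductivity.Theorems.TwoVolumeLip

set_option linter.dupNamespace false -- summit = problem name (single-conjunct summit), D-0017

open Finset Literature.MathematicalPhysics.QuantumLattice GrassmannAlgebra Literature.Probability.LatticeModels
  Literature.Probability.LatticeModels.BattleFederbush
open Literature.MathematicalPhysics.QuantumLattice.FermiRG
open Summit.HubbardSuperconductivity.HubbardSuperconductivity.Theorems.KLRegimeSplit
open Summit.HubbardSuperconductivity.HubbardSuperconductivity.Theorems.KLProgrammeLegKernels
open Summit.HubbardSuperconductivity.HubbardSuperconductivity.Theorems.DispersionFlow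
open Summit.HubbardSuperconductivity.HubbardSuperconductivity.Theorems.EngineV8
open Summit.HubbardSuperconductivity.HubbardSuperconductivity.Theorems.TwoVolumeSource
open Summit.HubbardSuperconductivity.HubbardSuperconductivity.Theorems.TwoVolumeDefect
open Summit.HubbardSuperconductivity.HubbardSuperconductivity.Theorems.TwoPointAssembly

/-- **The kernel of the glued coarse grid element is the keyed reading of the coarse kernel** (`kernel_copies_sum` at `klGridBlockEmb_apply`, explicit form by
`keyed_klGridBlockEquiv_eq`). -/
theorem kernel_klGridGlue_eq_keyed {L b M : ℕ} [NeZero L] [NeZero (b * L)] (W : GrassmannAlgebra ℂ (GridLeg (GridPoint L (klGridN M))))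
    {m : ℕ} (p : Fin m) (X : Fin m → GridLeg (GridPoint (b * L) (klGridN M))) :
    kernel ℂ (klGridGlue L b M W) m X =
      if ∀ i j, ((X i).1.1.2 j).val / L = ((X p).1.1.2 j).val / L then
        kernel ℂ W m (fun i => ((((X i).1.1.1, fun j => ((((X i).1.1.2 j).val : ℕ) : ZMod L)), (X i).1.2), (X i).2)) else 0 := by
  classical
  rw [klGridGlue_def, kernel_copies_sum (klGridBlockEquiv L b M) (klGridBlockEmb L b M) (fun β' v X' => klGridBlockEmb_apply β' v X') W p X,
    keyed_klGridBlockEquiv_eq W p X]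

set_option maxHeartbeats 400000 in -- M4a's statement is large
/-- **G-4 (datum) — the grid defect of the UV actions at a deep grid pin, common frame.**  M4a with `N := klGridN M`, `L″ := bL`, `K″ := K`, the covariances the grid
pull-backs of `C^K_{>klE0}` (hypotheses `hCL`, `hCLf`), read for `klGridActionZero (bL) − klGridGlue (klGridActionZero L)`; every other binder is M4a's, verbatim. -/
theorem lipBaseGridDefect_pinned_le {L b M : ℕ} [NeZero L] [NeZero (b * L)] [NeZero M] [LinearOrder (GridLeg (GridPoint (b * L) (klGridN M)))]
    {β : ℝ} (hβ : 0 < β) (U μ : ℝ) (K : TrigPolyC4v)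
    (CL : Matrix (GridLeg (GridPoint L (klGridN M))) (GridLeg (GridPoint L (klGridN M))) ℂ)
    (hCL : CL = (hubbardGridSub L M β (klGridN M)).transpose * hubbardCovAboveCT L M β μ 0 K klE0 * hubbardGridSub L M β (klGridN M))
    (CLf : Matrix (GridLeg (GridPoint (b * L) (klGridN M))) (GridLeg (GridPoint (b * L) (klGridN M))) ℂ)
    (hCLf : CLf = (hubbardGridSub (b * L) M β (klGridN M)).transpose * hubbardCovAboveCT (b * L) M β μ 0 K klE0 * hubbardGridSub (b * L) M β (klGridN M))
    -- depth of the zone, extra depth of the pin, the pin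
    (R R' : ℕ) (hRK : K.degree < R)
    (w : GridLeg (GridPoint (b * L) (klGridN M))) (hw : ∀ j, R + R' ≤ (w.1.1.2 j).val % L ∧ (w.1.1.2 j).val % L + (R + R') < L)
    -- decay numbers of the two covariances
    {T : ℝ} (hT0 : 0 < T) (hT : ∀ X', ∑ Y' ∈ univ.filter (fun Y' : GridLeg (GridPoint (b * L) (klGridN M)) => R < Torus.tnorm (X'.1.1.2 - Y'.1.1.2)), ‖CLf X' Y'‖ ≤ T)
    {Te : ℝ} (hsec : ∀ (X' : GridLeg (GridPoint (b * L) (klGridN M))) (t : Fin (klGridN M)) (σ c : Fin 2),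
      ∑ y ∈ univ.filter (fun y : TorusSite 2 (b * L) => R < Torus.tnorm (X'.1.1.2 - y)), ‖CLf X' (((t, y), σ), c)‖ ≤ Te)
    {s s' : ℝ} (hs0 : 0 ≤ s) (hs'0 : 0 ≤ s') (hs : ∀ X Y, ‖CL X Y‖ ≤ s) (hs' : ∀ X' Y', ‖CLf X' Y'‖ ≤ s')
    {α α' : ℝ} (hαα : 0 < α' + α) (hrow : ∀ X, ∑ Y, ‖CL X Y‖ ≤ α) (hrow' : ∀ X', ∑ Y', ‖CLf X' Y'‖ ≤ α')
    {m₁ m₁' : ℝ} (hm0 : 0 ≤ m₁) (hm0' : 0 ≤ m₁')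
    (hm1 : ∀ X, ∑ Y, ‖CL X Y‖ * (Torus.tnorm (X.1.1.2 - Y.1.1.2) : ℝ) ≤ m₁)
    (hm1' : ∀ X', ∑ Y', ‖CLf X' Y'‖ *
      (Torus.tnorm ((fun i => (((X'.1.1.2 i).val : ℕ) : ZMod L)) - fun i => (((Y'.1.1.2 i).val : ℕ) : ZMod L)) : ℝ) ≤ m₁')
    -- replica-Gram-boundedness of the two covariances
    {κ κ' : ℝ} (hκ : 0 < κ) (hκ' : 0 < κ') (hGB : IsGramBoundedR CL κ) (hGB' : IsGramBoundedR CLf κ')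
    -- the coarse partition function and OUTPUT weighted profile, and the two smallness conditions of the covariance bracket
    (hZ : IsUnit (effPartitionFn ℂ CL (hubbardGridInteraction L (klGridN M) β U + hubbardGridCounterQuadratic L (klGridN M) β K)))
    (Nw : ℕ → ℝ) (hNw0 : ∀ m, 0 ≤ Nw m)
    (hNw : ∀ (m' : ℕ) (j : Fin (2 * m')) (x : GridLeg (GridPoint L (klGridN M))),
      ∑ Y ∈ univ.filter (fun Y : Fin (2 * m') → GridLeg (GridPoint L (klGridN M)) => Y j = x),
        ‖kernel ℂ (effAction ℂ CL (hubbardGridInteraction L (klGridN M) β U + hubbardGridCounterQuadratic L (klGridN M) β K)) (2 * m') Y‖ *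
          (1 + labelDiam (fun Y₁ Y₂ : GridLeg (GridPoint L (klGridN M)) => (Torus.tnorm (Y₁.1.1.2 - Y₂.1.1.2) : ℝ)) (univ.image Y)) ≤ Nw m')
    {ρf : ℝ} (hρf : 0 < ρf)
    (hθw : Real.exp 1 * (α' + α + (m₁' + m₁)) * normV (GridLeg (GridPoint (b * L) (klGridN M))) (κ' + κ) ρf Nw / (κ' + κ) ^ 2 < 1)
    {ρ₂ : ℝ} (hρ₂ : 0 < ρ₂)
    (hθ₂ : Real.exp 1 * (α' + α + (m₁' + m₁)) * normV (GridLeg (GridPoint (b * L) (klGridN M))) (κ' + κ + (κ' + κ + (κ' + κ))) ρ₂ Nw /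
      (κ' + κ + (κ' + κ + (κ' + κ))) ^ 2 < 1)
    -- the INTERACTION bracket: weighted rows of the fine covariance in the block-periodic residue distance, majorant budgets of the three model profiles
    {αw : ℝ} (hαw : 0 < αw)
    (hroww : ∀ X', ∑ Y', ‖CLf X' Y'‖ *
      (1 + (Torus.tnorm ((fun i => (((X'.1.1.2 i).val : ℕ) : ZMod L)) - fun i => (((Y'.1.1.2 i).val : ℕ) : ZMod L)) : ℝ)) ≤ αw)
    (hcolw : ∀ Y', ∑ X', ‖CLf X' Y'‖ *
      (1 + (Torus.tnorm ((fun i => (((X'.1.1.2 i).val : ℕ) : ZMod L)) - fun i => (((Y'.1.1.2 i).val : ℕ) : ZMod L)) : ℝ)) ≤ αw)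
    (NV ND E : ℕ → ℝ) (hNV0 : ∀ m', 0 ≤ NV m') (hND0 : ∀ m', 0 ≤ ND m') (hE0 : ∀ m', 0 ≤ E m')
    (hNV : ∀ m', (if m' = 1 then |β| / (klGridN M : ℕ) * ∑ z : TorusSite 2 L, ‖framePosKernel L K z‖ * (1 + torusSiteDist z 0)
      else if m' = 2 then |U| * |β| / (klGridN M : ℕ) else 0 : ℝ) ≤ NV m')
    (hND : (1 + (R : ℝ)) * (|β| / (klGridN M : ℕ) * (K.coeffNorm 0 + K.coeffNorm 0)) ≤ ND 1)
    (hE : |β| / (klGridN M : ℕ) * (fsub K K).coeffNorm 0 ≤ E 1)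
    {ρ' : ℝ} (hρ' : 0 < ρ') {νEbar : ℝ} (hνE : normV (GridLeg (GridPoint (b * L) (klGridN M))) κ' ρ' E ≤ νEbar)
    (hbar : Real.exp 1 * αw * (normV (GridLeg (GridPoint (b * L) (klGridN M))) κ' ρ' (fun m' => NV m' + ND m') + νEbar) / κ' ^ 2 < 1)
    (hθ₂' : Real.exp 1 * αw * (normV (GridLeg (GridPoint (b * L) (klGridN M))) κ' ρ' NV + normV (GridLeg (GridPoint (b * L) (klGridN M))) κ' ρ' ND) / κ' ^ 2 < 1)
    (n : ℕ) (p : Fin (n + 1)) :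
    ∑ X ∈ univ.filter (fun X : Fin (n + 1) → GridLeg (GridPoint (b * L) (klGridN M)) => X p = w),
        ‖kernel ℂ (klGridActionZero (b * L) M β U μ K - klGridGlue L b M (klGridActionZero L M β U μ K)) (n + 1) X‖ ≤
            (ρ'⁻¹ ^ (n + 1) * Real.exp 1 / (1 - Real.exp 1 * αw * (normV (GridLeg (GridPoint (b * L) (klGridN M))) κ' ρ' (fun m' => NV m' + ND m') + νEbar) / κ' ^ 2) ^ 2) * normV (GridLeg (GridPoint (b * L) (klGridN M))) κ' ρ' E +
        (ρ'⁻¹ ^ (n + 1) * (Real.exp 1 * normV (GridLeg (GridPoint (b * L) (klGridN M))) κ' ρ' ND) / (1 - Real.exp 1 * αw * (normV (GridLeg (GridPoint (b * L) (klGridN M))) κ' ρ' NV + normV (GridLeg (GridPoint (b * L) (klGridN M))) κ' ρ' ND) / κ' ^ 2) ^ 2) * (1 + ((R' : ℝ) + 1))⁻¹ +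
        ((((n + 1 + 1) * (n + 1 + 2) : ℕ) : ℝ) / 2 *
            (ρ₂⁻¹ ^ (n + 3) * (Real.exp 1 * normV (GridLeg (GridPoint (b * L) (klGridN M))) (κ' + κ + (κ' + κ + (κ' + κ))) ρ₂ Nw) / (1 - Real.exp 1 * (α' + α + (m₁' + m₁)) * normV (GridLeg (GridPoint (b * L) (klGridN M))) (κ' + κ + (κ' + κ + (κ' + κ))) ρ₂ Nw / (κ' + κ + (κ' + κ + (κ' + κ))) ^ 2))) * Te +
        (‖(2 : ℂ)⁻¹‖ * ∑ a ∈ range (n + 2), ∑ b' ∈ range (n + 2),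
            (if a + b' = n + 1 then (((a + 1) * (b' + 1) : ℕ) : ℝ) *
              (4 * (ρ₂⁻¹ ^ (a + 1) * (Real.exp 1 * normV (GridLeg (GridPoint (b * L) (klGridN M))) (κ' + κ + (κ' + κ + (κ' + κ))) ρ₂ Nw) / (1 - Real.exp 1 * (α' + α + (m₁' + m₁)) * normV (GridLeg (GridPoint (b * L) (klGridN M))) (κ' + κ + (κ' + κ + (κ' + κ))) ρ₂ Nw / (κ' + κ + (κ' + κ + (κ' + κ))) ^ 2)) *
                (ρ₂⁻¹ ^ (b' + 1) * (Real.exp 1 * normV (GridLeg (GridPoint (b * L) (klGridN M))) (κ' + κ + (κ' + κ + (κ' + κ))) ρ₂ Nw) / (1 - Real.exp 1 * (α' + α + (m₁' + m₁)) * normV (GridLeg (GridPoint (b * L) (klGridN M))) (κ' + κ + (κ' + κ + (κ' + κ))) ρ₂ Nw / (κ' + κ + (κ' + κ + (κ' + κ))) ^ 2))) else 0)) * T +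
        ((((n + 1 + 1) * (n + 1 + 2) : ℕ) : ℝ) / 2 * (s' + s) *
              (ρf⁻¹ ^ (n + 3) * (Real.exp 1 * normV (GridLeg (GridPoint (b * L) (klGridN M))) (κ' + κ) ρf Nw) / (1 - Real.exp 1 * (α' + α + (m₁' + m₁)) * normV (GridLeg (GridPoint (b * L) (klGridN M))) (κ' + κ) ρf Nw / (κ' + κ) ^ 2)) +
            ‖(2 : ℂ)⁻¹‖ * ∑ a ∈ range (n + 2), ∑ b' ∈ range (n + 2),
              (if a + b' = n + 1 then (((a + 1) * (b' + 1) : ℕ) : ℝ) *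
                (2 * (α' + α) * (ρf⁻¹ ^ (a + 1) * (Real.exp 1 * normV (GridLeg (GridPoint (b * L) (klGridN M))) (κ' + κ) ρf Nw) / (1 - Real.exp 1 * (α' + α + (m₁' + m₁)) * normV (GridLeg (GridPoint (b * L) (klGridN M))) (κ' + κ) ρf Nw / (κ' + κ) ^ 2)) *
                  (ρf⁻¹ ^ (b' + 1) * (Real.exp 1 * normV (GridLeg (GridPoint (b * L) (klGridN M))) (κ' + κ) ρf Nw) / (1 - Real.exp 1 * (α' + α + (m₁' + m₁)) * normV (GridLeg (GridPoint (b * L) (klGridN M))) (κ' + κ) ρf Nw / (κ' + κ) ^ 2))) else 0)) * ((R' : ℝ) + 1)⁻¹ := by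
  classical
  haveI : NeZero (klGridN M) := ⟨mul_ne_zero two_ne_zero (mul_ne_zero two_ne_zero (NeZero.ne M))⟩
  -- M4a at the common covariance frame `K`, fine counterterm frame `K″ := K`, with the common volume-free sampled symbol at cutoff `klE0`
  obtain ⟨hCc_eq, hpc⟩ := hubbardCovAboveCT_eq_normalCovariance_sampled (V := L) (M := M) hβ μ K klE0
  obtain ⟨hCf_eq, hpf⟩ := hubbardCovAboveCT_eq_normalCovariance_sampled (V := b * L) (M := M) hβ μ K klE0
  have hD := hubbardGrid_sum_norm_kernel_twoVolume_stepZero_le (b := b) (L := L) (Lf := b * L) (M := M) (N := klGridN M) rfl hβ.ne'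
    (fun (i : MatsubaraIdx M) (_ : Fin 2) (q : Fin 2 → ℝ) => uvSymbolFn 1 klE0 (-2 * ∑ l, Real.cos (q l) - μ - K.eval q) (matsubaraFreq β M i)) _ _ hpc hpf
    CL (by rw [hCL, hCc_eq]) CLf (by rw [hCLf, hCf_eq]) U K K R R' hRK hRK w hw hT0 hT hsec hs0 hs'0 hs hs' hαα hrow hrow' hm0 hm0' hm1 hm1' hκ hκ' hGB hGB' hZ Nw hNw0 hNw
    hρf hθw hρ₂ hθ₂ hαw hroww hcolw NV ND E hNV0 hND0 hE0 hNV hND hE hρ' hνE hbar hθ₂' n p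
  -- read the glued kernel as the keyed coarse kernel
  refine le_of_eq_of_le (Finset.sum_congr rfl fun X _ => ?_) hD
  rw [kernel_sub', kernel_klGridGlue_eq_keyed _ p X, klGridActionZero_def, klGridActionZero_def, ← hCL, ← hCLf]

end Summit.HubbardSuperconductivity.HubbardSuperconductivity.Theorems.TwoVolumeLip

end
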